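import Mathlib
import Literature.AlgebraicGeometry.Resolution.TeissierPresentation
import Summits.ResolutionOfSingularities.ResolutionOfSingularities.Theses.TeissierJung

/-!
# Sketch — first lemmas of the round-1 crux ideas for `TeissierReduction` (ideator k = 1)

Card `codim-one-residual-separability`: `FerociousFoldNotTeissier`, `SecondPolarVanishesCharTwo`.
Card `maclane-fan-residual-induction`: `EisensteinGermTeissier`.
Card `transversal-strict-transform`: `StrictTransformIntegralOverBlowupAlgebra`.
Statements only (Props); nothing is proved here.
-/

open Polynomial

noncomputable section

set_option linter.dupNamespace false

namespace Summit.ResolutionOfSingularities.ResolutionOfSingularities.Cruxes.TeissierReduction.IdeasR1K1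

open Literature.AlgebraicGeometry.Resolution

/-- Card 1, first lemma. The FEROCIOUS FOLD `B = k⟦x₀,x₁⟧[z]/(z² + x₀ z + x₁)` (char 2; `B` is
regular, rank 2, generically étale over `k⟦x⟧` with discriminant `x₀²`, and the residue extension
along `x₀ = 0` is `k((x₁)) ⊂ k((z))`, `x₁ = z²`, purely inseparable) admits NO Teissier presentation
over `k⟦x₀,x₁⟧` in ANY formal coordinates (`φ` ranges over all automorphisms of `k⟦x⟧`). -/
def FerociousFoldNotTeissier : Prop :=
  ∀ (k : Type) [Field k] [CharP k 2] [IsAlgClosed k],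
    ∀ φ : MvPowerSeries (Fin 2) k ≃+* MvPowerSeries (Fin 2) k,
      ¬ TeissierPresentation k 2
          (AdjoinRoot (X ^ 2 + C (MvPowerSeries.X (0 : Fin 2)) * X +
            C (MvPowerSeries.X (1 : Fin 2)) : Polynomial (MvPowerSeries (Fin 2) k)))
          ((AdjoinRoot.of (X ^ 2 + C (MvPowerSeries.X (0 : Fin 2)) * X +
            C (MvPowerSeries.X (1 : Fin 2)) : Polynomial (MvPowerSeries (Fin 2) k))).comp
              φ.toRingHom)

/-- Card 1, second lemma (why LINEAR projections are ferocious in characteristic 2): the second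
polar `D_O(D_O F)` of any polynomial vanishes identically in characteristic `2`
(`∂²x^m/∂x² = m(m-1)x^{m-2} ≡ 0`, mixed terms come twice). Consequence (paper): for a projection
centre `O ∉ H = V(F)`, the line `OP` is tangent to the contour `R_O = H ∩ V(D_O F)` at every
`P ∈ R_O`, so `R_O → branch divisor` is inseparable. -/
def SecondPolarVanishesCharTwo : Prop :=
  ∀ (k : Type) [CommRing k] [CharP k 2] (n : ℕ) (F : MvPolynomial (Fin n) k) (O : Fin n → k),
    (∑ i : Fin n, O i • MvPolynomial.pderiv i (∑ j : Fin n, O j • MvPolynomial.pderiv j F)) = 0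

/-- Card 2, first lemma (base case of the residual induction = "generic Teissier along a divisor
with étale residue"): an EISENSTEIN-TYPE Weierstrass polynomial `z^e + a_{e-1} z^{e-1} + ⋯ + a_0`
over `k⟦x₀,…,x_{d-1}⟧` with all `a_i ∈ (x₀)` and `a_0 = x₀ · unit` defines a Teissier-presented
germ (`g = 1`, binomial `z^e − c x₀`, everything else overweight). -/
def EisensteinGermTeissier : Prop :=
  ∀ (k : Type) [Field k] [IsAlgClosed k] (d e : ℕ) (hd : 0 < d) (he : 2 ≤ e)
    (a : Fin e → MvPowerSeries (Fin d) k),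
    (∀ i, MvPowerSeries.X (⟨0, hd⟩ : Fin d) ∣ a i) →
    (∃ u : (MvPowerSeries (Fin d) k)ˣ,
        a ⟨0, by omega⟩ = MvPowerSeries.X (⟨0, hd⟩ : Fin d) * (u : MvPowerSeries (Fin d) k)) →
    TeissierPresentation k d
      (AdjoinRoot (X ^ e + ∑ i : Fin e, C (a i) * X ^ (i : ℕ) :
        Polynomial (MvPowerSeries (Fin d) k)))
      (AdjoinRoot.of (X ^ e + ∑ i : Fin e, C (a i) * X ^ (i : ℕ) :
        Polynomial (MvPowerSeries (Fin d) k)))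

/-- Card 3, first lemma (strict transforms under blow-ups of TRANSVERSAL centres stay finite over
the blown-up base; ring-level core): if `f = z^n + Σ a_i z^i` with `a_i ∈ I^{n-i}` (equimultiple
of multiplicity `n` along `V(I)` for a transversal projection) and `t ∈ I`, then `z/t` is integral
over the affine blow-up algebra `A[I/t] ⊆ A[1/t]`: it satisfies the monic equation with
coefficients `a_i / t^{n-i} ∈ A[I/t]`. Stated as membership of those coefficients. -/
def StrictTransformIntegralOverBlowupAlgebra : Prop :=
  ∀ (A : Type) [CommRing A] (I : Ideal A) (t : A), t ∈ I → ∀ (n : ℕ) (a : Fin n → A),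
    (∀ i : Fin n, a i ∈ I ^ (n - i)) →
    ∀ i : Fin n,
      IsLocalization.mk' (Localization.Away t) (a i)
          ⟨t ^ (n - i), Submonoid.pow_mem _ (Submonoid.mem_powers t) _⟩ ∈
        Algebra.adjoin A
          {y : Localization.Away t | ∃ b ∈ I, y = IsLocalization.mk' (Localization.Away t) b
            ⟨t, Submonoid.mem_powers t⟩}

end Summit.ResolutionOfSingularities.ResolutionOfSingularities.Cruxes.TeissierReduction.IdeasR1K1

end
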